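import Summits.Ventures.HSemireg.LemmaCFrameClassDead
import Summits.Ventures.HSemireg.DividedSquareParity

/-!
# LEMMA C for EVERY integral class 2-form (pub-hsemireg, S4-PUSH corner 2)

Kernel leg of seat s4-search-2 gen 17 (cell `pub-hsemireg`), ROW Q; composition of ROW M
(`LemmaCFrameClassDead.lemmaC_classDead`: the `E = ∅` type `(2,2,2,3,3,3)` of the M2 cell is CLASS-DEAD at `k = 2`
for every leading digit `β = ι a ι b` of rank `≤ 2`) with ROWS O ∕ P (`DecomposableTwoForms`,
`DividedSquareParity`).  The point: for this type the `k = 2` condition ITSELF forces the leading digit to have rank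
`≤ 2` — `T₂ = σ₂D₂ − 4σ₁DB + 16σ₀B₂` with `σ₁ = 0`, `σ₂ = 4t + 2`, `σ₀ = 2s + 1`, `D₂ = 16P₂ + 32PQ + 64Q₂` is
`32·W₁ + 16·B₂`, so `T₂ ∈ 64Λ` gives `B₂ ∈ 2Λ`, i.e. `B·B ∈ 4Λ`, and `DividedSquareParity.exists_eq_ι_mul_ι_add_two_mul_of_sq`
writes `B = ι a ι b + 2X` — whereupon ROW M applies verbatim.  So the hypothesis «`B = ι a ι b + 2X`» of ROW M (the
framework word «leading-digit identification», precision S-N-2 of s4-ref g48 V#7) is discharged inside the kernel: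
`lemmaC_classDead_of_mem_span` holds for ANY `B` in the `ℤ`-span of the 2-vectors.

Scope ∕ honest framing as in ROW M: a CLASS-LEVEL statement for ONE unit type of a NECESSARY-condition sieve
(CRITERION L) at the special fibre `E⁶`; that CRITERION L is the registered necessary condition, the signature table
(`σ₁ = 0`, `v₂(σ₂) = 1`, `σ₀` odd on these 63 classes) and the census remain framework words; theorems only
(count-neutral, no `def`); no object, no `σ` computation, no Hodge statement; nothing here bears on HC ∕ HC_CM ∕ HC_AV.
-/

namespace Summit.Ventures.HSemireg.LemmaCEveryDigit

open ExteriorAlgebra LemmaCFrameClassDead DividedSquareParity LeadingDigitRemainder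

variable {M : Type*} [AddCommGroup M] [Module ℤ M]

set_option maxHeartbeats 800000 in
/-- **LEMMA C WITHOUT THE LEADING-DIGIT HYPOTHESIS.**  Setting of `LemmaCFrameClassDead.lemmaC_classDead` (the
`E = ∅` type `(2,2,2,3,3,3)`: slots `hᵢ = ι x₂ᵢ ι x₂ᵢ₊₁` of a basis `x : Fin 12`, `P, Q, P₂, Q₂`, `D = 4P + 8Q`,
`D₂ = 16P₂ + 32PQ + 64Q₂`, signature `σ₁ = 0`, `σ₂ = 4t + 2`, `σ₀ = 2s + 1` with `s, t ∈ Λ`, the registered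
`T₂(B) = σ₂D₂ − 4σ₁DB + 16σ₀B₂`), but the class 2-form `B` is now ANY element of the `ℤ`-span of the 2-vectors
(any integral 2-form) with ANY `B₂` such that `B·B = 2B₂` — no «leading digit `β = ι a ι b`» hypothesis.  THEN
`∀ Z ∈ Λ, T₂(B) ≠ 64·Z`: CRITERION L fails at `k = 2` for EVERY integral class 2-form of this type.
Proof: `T₂ = 32·W₁ + 16·B₂` (`noncomm_ring`), so `T₂ = 64Z` forces `B₂ = 2·(2Z − W₁)` (cancel `16`,
`LeadingDigitRemainder.natCast_mul_cancel`), i.e. `B·B ∈ 4Λ`; by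
`DividedSquareParity.exists_eq_ι_mul_ι_add_two_mul_of_sq` the 2-form is then `ι a ι b + 2X` with `X` in the
span of the 2-vectors — and `lemmaC_classDead` applies verbatim. -/
theorem lemmaC_classDead_of_mem_span (x : Module.Basis (Fin 12) ℤ M) (Λ : Subalgebra ℤ (ExteriorAlgebra ℤ M))
    (h₀ h₁ h₂ h₃ h₄ h₅ σ₀ σ₁ σ₂ s t P Q P₂ Q₂ D D₂ B B₂ T₂ : ExteriorAlgebra ℤ M)
    (hΛ : Λ = Algebra.adjoin ℤ (Set.range fun p : M × M => ι ℤ p.1 * ι ℤ p.2))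
    (hh₀ : h₀ = ι ℤ (x 0) * ι ℤ (x 1)) (hh₁ : h₁ = ι ℤ (x 2) * ι ℤ (x 3)) (hh₂ : h₂ = ι ℤ (x 4) * ι ℤ (x 5))
    (hh₃ : h₃ = ι ℤ (x 6) * ι ℤ (x 7)) (hh₄ : h₄ = ι ℤ (x 8) * ι ℤ (x 9)) (hh₅ : h₅ = ι ℤ (x 10) * ι ℤ (x 11))
    (ms : s ∈ Λ) (mt : t ∈ Λ)
    (hP : P = h₀ + h₁ + h₂) (hQ : Q = h₃ + h₄ + h₅) (hP₂ : P₂ = h₀ * h₁ + h₀ * h₂ + h₁ * h₂)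
    (hQ₂ : Q₂ = h₃ * h₄ + h₃ * h₅ + h₄ * h₅) (hD : D = 4 * P + 8 * Q) (hD₂ : D₂ = 16 * P₂ + 32 * (P * Q) + 64 * Q₂)
    (mB : B ∈ Submodule.span ℤ (Set.range fun p : M × M => ι ℤ p.1 * ι ℤ p.2)) (qB : B * B = 2 * B₂)
    (hσ₁ : σ₁ = 0) (hσ₂ : σ₂ = 4 * t + 2) (hσ₀ : σ₀ = 2 * s + 1)
    (hT₂ : T₂ = σ₂ * D₂ - 4 * σ₁ * (D * B) + 16 * σ₀ * B₂) :
    ∀ Z ∈ Λ, T₂ ≠ 64 * Z := by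
  intro Z mZ hcrit
  -- `T₂ = 32·W₁ + 16·B₂`
  obtain ⟨W₁, hW₁⟩ : ∃ W₁ : ExteriorAlgebra ℤ M,
      W₁ = 2 * t * P₂ + P₂ + 4 * t * (P * Q) + 2 * (P * Q) + 8 * t * Q₂ + 4 * Q₂ + s * B₂ := ⟨_, rfl⟩
  have e : T₂ = 32 * W₁ + 16 * B₂ := by
    rw [hW₁, hT₂, hσ₁, hσ₂, hσ₀, hD₂]; noncomm_ring
  -- cancel `16`: `B₂ = 2·(2Z − W₁)`, so `B·B ∈ 4Λ`
  have h16 : (16 : ExteriorAlgebra ℤ M) * B₂ = 16 * (2 * (2 * Z - W₁)) := by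
    rw [eq_sub_of_add_eq' (e.symm.trans hcrit)]; noncomm_ring
  have hB₂ : B₂ = 2 * (2 * Z - W₁) := natCast_mul_cancel x 16 (by norm_num) _ _ (by exact_mod_cast h16)
  have hBB : B * B = 4 * (2 * Z - W₁) := by rw [qB, hB₂]; noncomm_ring
  -- the leading digit is decomposable
  obtain ⟨a, b, X, mX, hB⟩ := exists_eq_ι_mul_ι_add_two_mul_of_sq x B _ mB hBB
  -- LEMMA C
  exact lemmaC_classDead x Λ h₀ h₁ h₂ h₃ h₄ h₅ σ₀ σ₁ σ₂ s t P Q P₂ Q₂ D D₂ X B B₂ T₂ a b hΛ hh₀ hh₁ hh₂ hh₃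
    hh₄ hh₅ ms mt hP hQ hP₂ hQ₂ hD hD₂ mX hB qB hσ₁ hσ₂ hσ₀ hT₂ Z mZ hcrit

end Summit.Ventures.HSemireg.LemmaCEveryDigit
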